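import Literature.MathematicalPhysics.QuantumFieldTheory.Balaban1983to89.B9Thm311SitePrimeFormCoerciveTowerPlaquette
import Literature.MathematicalPhysics.QuantumFieldTheory.Balaban1983to89.B9Eq3115QkGaugeModeTower
import Literature.MathematicalPhysics.QuantumFieldTheory.Balaban1983to89.B7Eq214FlatQprime
import HarnessLib

/-!
# Route `UnitScaleTilt`, crux K1 «MinimiserStabilityRegPr» (stmt-QuantumFields-19200) — LANE II «DIVERGENCE RECOVERY AT CURVED `W`» (★★OWNER RULING №23),
# brick (B5) «BLOCK POINCARÉ ON `ker Q′_k(W)`», FILE 1∕2 (lit letters): **THE HIERARCHICAL `ker Q′_k` POINCARÉ INEQUALITY IS A COROLLARY OF THE LANDED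
# k-LEVEL SITE COERCIVITY [Balaban1985BackgroundPropagators] Thm 3.11 (site clause) AT THE PLAQUETTE CLASS (52)** — plus the `ℤᵈ` reading of the CURVED
# gauge-parameter tower `Q′_k(U)` (the flat twin is pub-ymgap's ✓`B9Eq319QprimeReadingZdPer.read_QprimeW_one_pow_eq_QprimeIter`)

Cell `ym3-torus` ∕ width seat `ym-ust-19200-w1` (gen 15).  THEOREMS ONLY (0 `def`, 0 `sorry`); `--supports stmt-QuantumFields-19200 --as helper`, count-neutral.
YM₃ on T³ is a ladder rung (R3), not d = 4, not infinite volume, not the Clay problem; nothing here claims the stub, the crux, `hN06`, (V3) or the mass gap.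

WHY (LANE II skeleton ★p1 g19 `SKELETON-LANE2-DIVREC` §3 (B5) `blockPoincare_kerQprime`).  The row wanted is: for every `W ∈ RegPr F n K e` and every gauge parameter
`λ` with `QprimeCombL2 F n K c₀ W λ = 0` (print's HIERARCHICAL comb site average `Q′_k(W)`, [Balaban1985BackgroundPropagators] (3.19), `k = K − n` levels, transporters
`W̄ʲ(Γ_{y,x})` of the AVERAGED backgrounds): `‖λ‖² ≤ CP·‖D_Wλ‖² + CP′·e²·‖λ‖²`.  This is NOT the one-shot corner-comb Poincaré of ✓`Prop7CovariantCoercivity.block_poincare_comb`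
(different kernel at curved `W`).  It IS, however, a corollary of a LANDED lit theorem of the pub-balaban NE9 chain (Tier P brick T5):
✓`B9Thm311SitePrimeFormCoerciveTowerPlaquette.exists_site_strong_coercive_tower_of_small_plaquettes` — print's Thm 3.11 for the k-level SITE operator
`Δ′_{a′,k}(U) = D*_UD_U + a′Q̃′_k(U)†Q̃′_k(U)` at the gauge-invariant plaquette class (52), with a LEVEL-FREE constant: `γ·(‖D_Uλ‖² + (ηN)⁻²‖λ‖²) ≤ re⟨λ, Δ′_{a′,k}(U)λ⟩`.
On `ker Q′_k(U)` the penalty vanishes (✓`laplacePrimeAk_apply_of_ker` ∕ ✓`re_inner_laplacePrimeAk`), whence `‖λ‖² ≤ γ⁻¹·(ηN)²·‖D_Uλ‖²` — §3 below.  §1–§2 supply the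
`ℤᵈ` reading of the curved tower `QprimeTowerW L m n φ U` as lit-balaban's `QprimeIter (zdBlocking d L) (bgT L Ũ) (n+1)` (one step = ✓`B9Eq3115QkGaugeModeTower.toAlg_QprimeLin`,
levels by ✓`B9Eq315QTower.perCfg_UlevOf`), so that the member file (FILE 2) can feed the kernel hypothesis of ✓`Prop7QprimeCombL2.QprimeCombL2_eq_zero_iff` into it.

WHAT IS PROVED (ns `…Theorems.Prop7KerQprimePoincareNE9`; `ℤᵈ` ∕ torus-tower letters of lit `B7Eq78Linearization` ∕ `B9Eq315QTower` ∕ `B9Eq326OperatorTower`):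
* §1 `QprimeIter_zdBlocking_succ_left` — peeling the FINEST level of the `ℤᵈ` comb tower: `Q′_{n+1}[T] = Q′_n[T∘succ] ∘ Q′_1[T]` (the blocking data of `zdBlocking` are level-free).
* §2 ★★`read_QprimeTower_eq_QprimeIter` (generic level families, induction on the number of levels), ★★`read_QprimeTowerW_eq_QprimeIter`
  (`φ((Q′_k(U)λ)(y)) = (QprimeIter (zdBlocking d L) (bgT L Ũ) k (φ∘λ∘perSite))(liftSite y)`, `Ũ = perCfg U`), ★`QprimeTowerW_eq_zero_of_forall_QprimeIter_eq_zero`.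
* §3 ★★★`exists_normSq_le_of_ker_QprimeTowerW` — `∃ A₁ CP > 0` BEFORE every lattice ∕ level ∕ background binder: at the class (52) with `M_φM_φ′α₀ ≤ A₁`,
  `Q′_k(U)λ = 0 ⟹ ‖λ‖² ≤ CP·(ηL^k)²·‖D_Uλ‖²` (`CP = 2(3 + 4∕a′)` at the pen's `a′`; on print's diagonal `ηL^k = 1`).
HONEST SCOPE.  Bookkeeping over landed lit theorems; no new estimate; the member reading (route letters `QprimeCombL2`, `DL2`, `RegPr`, the `basePt` translation) is FILE 2.
Rung R3 (YM₃ on T³), not Clay; YM gap NOT proved.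

References: T. Bałaban, CMP **99** (1985) 389–434 [Balaban1985BackgroundPropagators] ((3.19) p.393, (3.24) p.394, (3.35) p.396, Thm 3.11 p.416); CMP **98** (1985) 17–51
[Balaban1985Averaging] ((2) p.17, (42)–(43) pp.23–24, (52) p.26, (78)–(80) p.30).
-/

set_option autoImplicit false

noncomputable section

open scoped BigOperators InnerProductSpace ComplexConjugate

namespace Summit.QuantumFields.YangMills.Theorems.Prop7KerQprimePoincareNE9

open Literature.MathematicalPhysics.QuantumFieldTheory.Balaban1983to89
open Literature.MathematicalPhysics.QuantumLattice (blockSites blockBase)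
open B4Sect5Torus (TSite)
open B9SectCLatticeCarrier (Bond)
open B7Prop1Explicit (boxVec U1 hol treeWord axialFn)
open B7Prop2Explicit (avgIter pdev C0 c2' AvgClosed)
open B7Eq78Linearization (conjR Qprime QprimeIter zdBlocking QprimeIter_zero QprimeIter_succ Qprime_apply)
open B8Eq119TwistedAxial (bgT)
open B9Eq311L2Pairing (WL2)
open B11Eq103H1Complex (SiteL2K covDerivL2K)
open B9Eq310HessianOperator (adTransportW)
open B9Eq319QprimeTorus (fineP QprimeLin)
open B9Eq315QTorus (perSite perCfg cornerSite)
open B9Eq315QTorusOnto (liftSite periodVec perSite_add_periodVec perSite_liftSite liftSite_perSite_add cornerSite_eq hol_perCfg_add_periodVec)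
open B9Eq315QTower (towerP UlevOf QprimeTower QprimeTower_zero QprimeTower_succ perCfg_UlevOf corner_eq_smul corner_periodVec)
open B9Eq326OperatorTower (QprimeTowerW)
open B9Eq324DeltaPrimeATower (laplacePrimeAk laplacePrimeAk_apply_of_ker re_inner_laplacePrimeAk)
open B9Eq3115QkGaugeModeTower (toAlg_QprimeLin)
open B9Thm311SmallFieldClosed (hRS_of_unitary)
open B9Thm311SitePrimeFormCoerciveTowerPlaquette (exists_site_strong_coercive_tower_of_small_plaquettes)
open B7Eq214FlatQprime (sum_blockSites_eq_sum_boxVec)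

variable {d : ℕ}

/-! ## §1 Peeling the finest level of the `ℤᵈ` comb tower -/

section Zd

variable {𝔸 : Type*} [NormedRing 𝔸] [NormedAlgebra ℂ 𝔸]

/-- ★ **PEELING THE FINEST LEVEL**: for the level-free blocking data of `zdBlocking d L`, `Q′_{n+1}[T]μ = Q′_n[T ∘ succ](Q′_1[T]μ)` — the composite of
(3.19) read with the finest factor innermost. [cite: Balaban1985BackgroundPropagators, (3.19) p.393] -/
theorem QprimeIter_zdBlocking_succ_left (L : ℕ) (T : ℕ → B7Prop1Explicit.Site d → B7Prop1Explicit.Site d → 𝔸ˣ) (μ : B7Prop1Explicit.Site d → 𝔸) :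
    ∀ n : ℕ, QprimeIter (zdBlocking d L) T (n + 1) μ = QprimeIter (zdBlocking d L) (fun j => T (j + 1)) n (QprimeIter (zdBlocking d L) T 1 μ)
  | 0 => rfl
  | n + 1 => by
    funext y
    rw [QprimeIter_succ, QprimeIter_succ, QprimeIter_zdBlocking_succ_left L T μ n]
    rfl

end Zd

/-! ## §2 The curved gauge-parameter tower `Q′_k(U)` read on `ℤᵈ` -/

section Reading

variable {𝔸 : Type*} [NormedRing 𝔸] [NormedAlgebra ℂ 𝔸] [CompleteSpace 𝔸] [NormOneClass 𝔸]
  {W : Type*} [NormedAddCommGroup W] [InnerProductSpace ℂ W] (φ : W ≃ₗ[ℂ] 𝔸)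
  (L : ℕ) [NeZero L] (m : Fin d → ℕ) [∀ i, NeZero (m i)]

omit [CompleteSpace 𝔸] [NormOneClass 𝔸] in
/-- ★ **ONE STEP OF (3.19) READ ON ALL OF `ℤᵈ`** (not only at representatives): for transporters `T₀ z x = Ṽ(Γ_{Lz,x})` (the comb of the periodic extension from
the corner `L•z`), `φ((Q′(V)l)(z mod P)) = Σ_{x∈B(z)} L^{−d}·R(T₀ z x)·φ(l(x mod LP))` — ✓`toAlg_QprimeLin` at the representative, the two corners `L·(z mod P)` and `L•z` differing
by a period of the fine torus, invisible to the periodic holonomy (✓`hol_perCfg_add_periodVec`) and to the reading (✓`perSite_add_periodVec`).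
[cite: Balaban1985BackgroundPropagators, (3.19) p.393; Balaban1985Averaging, (2) p.17, (9) p.18] -/
theorem read_QprimeLin_eq_Qprime (P : Fin d → ℕ) [∀ i, NeZero (P i)] (V : Bond d (fineP L P) → 𝔸ˣ) (l : TSite d (fineP L P) → W)
    (T₀ : B7Prop1Explicit.Site d → 𝔸ˣ) (z : B7Prop1Explicit.Site d) (hT₀ : ∀ x, T₀ x = axialFn (perCfg (fineP L P) V) ((L : ℤ) • z) x) :
    φ (QprimeLin L P (adTransportW φ V) l (perSite P z))
      = Qprime (blockSites L z) (fun _ => ((L : ℝ) ^ d)⁻¹) T₀ (fun x => φ (l (perSite (fineP L P) x))) := by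
  rw [toAlg_QprimeLin, Qprime_apply, sum_blockSites_eq_sum_boxVec]
  -- the base point of the torus step: `L•z = cornerSite L (perSite z) + (fine period)`
  obtain ⟨t, ht⟩ : ∃ t : B7Prop1Explicit.Site d, (L : ℤ) • z = cornerSite L (perSite P z) + periodVec (fineP L P) t := by
    refine ⟨fun i => z i / (P i : ℤ), ?_⟩
    rw [cornerSite_eq, corner_eq_smul, ← corner_periodVec, corner_eq_smul, ← smul_add, liftSite_perSite_add]
  refine Finset.sum_congr rfl fun r _ => ?_
  rw [hT₀, axialFn, add_sub_cancel_left, ht, add_right_comm, hol_perCfg_add_periodVec, perSite_add_periodVec]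

omit [CompleteSpace 𝔸] [NormOneClass 𝔸] in
/-- ★★ **THE TOWER READ ON `ℤᵈ`, GENERIC LEVEL FAMILIES** (induction on the number of levels): for level backgrounds `Ulev j` on the bonds of `T_{L^{j+1}m}` and a `ℤᵈ`
transporter family `T` with `T (n−1−j) z x = axialFn (Ũlev j) (L•z) x` (`j < n`; the composite's factor `j` is the step `T_{L^{j+1}m} → T_{L^jm}`, finest factor first),
`φ((Q′_n l)(y)) = (QprimeIter (zdBlocking d L) T n (φ ∘ l ∘ perSite))(liftSite y)` — one step is ✓`toAlg_QprimeLin`, the base points `L·liftSite(perSite z)` and `L•z`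
differ by a fine period, invisible to the periodic holonomies and readings. [cite: Balaban1985BackgroundPropagators, (3.19) p.393; Balaban1985Averaging, (2) p.17, (78) p.30] -/
theorem read_QprimeTower_eq_QprimeIter :
    ∀ (n : ℕ) (Ulev : (j : ℕ) → Bond d (towerP L m (j + 1)) → 𝔸ˣ) (T : ℕ → B7Prop1Explicit.Site d → B7Prop1Explicit.Site d → 𝔸ˣ),
      (∀ j < n, ∀ z x : B7Prop1Explicit.Site d, T (n - 1 - j) z x = axialFn (perCfg (towerP L m (j + 1)) (Ulev j)) ((L : ℤ) • z) x) →
      ∀ (l : TSite d (towerP L m n) → W) (y : TSite d m),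
        φ (QprimeTower L m (fun j => adTransportW φ (Ulev j)) n l y)
          = QprimeIter (zdBlocking d L) T n (fun z => φ (l (perSite (towerP L m n) z))) (liftSite y)
  | 0, Ulev, T, _, l, y => by
    show φ (l y) = φ (l (perSite m (liftSite y)))
    rw [perSite_liftSite]
  | n + 1, Ulev, T, hT, l, y => by
    show φ (QprimeTower L m (fun j => adTransportW φ (Ulev j)) n (QprimeLin L (towerP L m n) (adTransportW φ (Ulev n)) l) y) = _
    -- the remaining `n` levels
    have IH := read_QprimeTower_eq_QprimeIter n Ulev (fun j => T (j + 1))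
      (fun j hj z x => by
        have h := hT j (Nat.lt_succ_of_lt hj) z x
        rw [show n + 1 - 1 - j = (n - 1 - j) + 1 by omega] at h
        exact h)
      (QprimeLin L (towerP L m n) (adTransportW φ (Ulev n)) l) y
    rw [IH, QprimeIter_zdBlocking_succ_left]
    congr 1
    -- the finest step: `read (Q′(Ulev n) l) = Q′_1[T] (read l)` on ALL of `ℤᵈ`
    funext z
    have hT0 : ∀ x, T 0 z x = axialFn (perCfg (fineP L (towerP L m n)) (Ulev n)) ((L : ℤ) • z) x := fun x => by
      have h := hT n (Nat.lt_succ_self n) z x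
      rwa [show n + 1 - 1 - n = 0 by omega] at h
    rw [QprimeIter_succ, QprimeIter_zero]
    exact read_QprimeLin_eq_Qprime φ L (towerP L m n) (Ulev n) l (T 0 z) z hT0

omit [NormOneClass 𝔸] in
/-- ★★ **PRINT'S `Q′_k(U)` ON THE `L²` GAUGE PARAMETERS, READ ON `ℤᵈ`**: for ONE background `U` on `T_{L^{n+1}m}`,
`φ((QprimeTowerW L m n φ U λ)(y)) = (QprimeIter (zdBlocking d L) (bgT L Ũ) (n+1) (φ ∘ λ ∘ perSite))(liftSite y)`, `Ũ = perCfg U` — the level backgrounds are the averages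
`Ū^{n−j}` (✓`perCfg_UlevOf`) and `bgT L Ũ j z x = Ūʲ(Γ_{Lz,x})` is the comb transporter of the `j`-th average. [cite: Balaban1985BackgroundPropagators, (3.19) p.393; Balaban1985Averaging, (43) p.24, (78)–(80) p.30] -/
theorem read_QprimeTowerW_eq_QprimeIter (n : ℕ) {c₀ : ℝ} (U : Bond d (towerP L m (n + 1)) → 𝔸ˣ) (l : SiteL2K ℂ d (towerP L m (n + 1)) c₀ W) (y : TSite d m) :
    φ (QprimeTowerW L m n φ U l y)
      = QprimeIter (zdBlocking d L) (bgT L (perCfg (towerP L m (n + 1)) U)) (n + 1)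
          (fun z => φ ((WL2.linearEquiv ℂ ℂ (fun _ : TSite d (towerP L m (n + 1)) => c₀)) l (perSite (towerP L m (n + 1)) z))) (liftSite y) := by
  rw [QprimeTowerW, LinearMap.comp_apply]
  refine read_QprimeTower_eq_QprimeIter φ L m (n + 1) (UlevOf L m (n + 1) U) _ (fun j hj z x => ?_) _ y
  rw [bgT, perCfg_UlevOf L m (Nat.succ_le_of_lt hj), show n + 1 - 1 - j = n - j by omega]
  rfl

omit [NormOneClass 𝔸] in
/-- ★ **KERNELS**: if the `ℤᵈ` comb tower of the reading vanishes identically, `Q′_k(U)λ = 0`. [cite: Balaban1985BackgroundPropagators, (3.19) p.393, (3.21) p.394] -/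
theorem QprimeTowerW_eq_zero_of_forall_QprimeIter_eq_zero (n : ℕ) {c₀ : ℝ} (U : Bond d (towerP L m (n + 1)) → 𝔸ˣ)
    (l : SiteL2K ℂ d (towerP L m (n + 1)) c₀ W)
    (h : ∀ z : B7Prop1Explicit.Site d, QprimeIter (zdBlocking d L) (bgT L (perCfg (towerP L m (n + 1)) U)) (n + 1)
      (fun z => φ ((WL2.linearEquiv ℂ ℂ (fun _ : TSite d (towerP L m (n + 1)) => c₀)) l (perSite (towerP L m (n + 1)) z))) z = 0) :
    QprimeTowerW L m n φ U l = 0 := by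
  funext y
  apply φ.injective
  rw [read_QprimeTowerW_eq_QprimeIter, h, Pi.zero_apply, map_zero]

end Reading

/-! ## §3 The `ker Q′_k` Poincaré inequality from Thm 3.11's site clause at the class (52) -/

section Poincare

variable {𝔸 : Type*} [NormedRing 𝔸] [NormedAlgebra ℂ 𝔸] [NormOneClass 𝔸] [StarRing 𝔸] [CompleteSpace 𝔸]
  {W : Type*} [NormedAddCommGroup W] [InnerProductSpace ℂ W] [FiniteDimensional ℂ W] (φ : W ≃ₗ[ℂ] 𝔸) (τ : 𝔸 →ₗ[ℂ] ℂ)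
  {Mφ Mφ' : ℝ} (hMφ : 0 ≤ Mφ) (hMφ' : 0 ≤ Mφ') (hφ : ∀ w, ‖φ w‖ ≤ Mφ * ‖w‖) (hφ' : ∀ X, ‖φ.symm X‖ ≤ Mφ' * ‖X‖)
  (hτφ : ∀ X Y : 𝔸, ⟪φ.symm X, φ.symm Y⟫_ℂ = τ (star X * Y)) (htr : ∀ X Y : 𝔸, τ (X * Y) = τ (Y * X))

include hMφ hMφ' hφ hφ' hτφ htr in
/-- ★★★ **THE `ker Q′_k(U)` POINCARÉ INEQUALITY AT THE PLAQUETTE CLASS (52), LEVEL-FREE** — `∃ A₁ CP > 0` BEFORE `∀ L ∀ S ∀ k ∀ m ∀ U ∀ α₀ ∀ η ∀ c₀ ∀ λ`: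
on every tower lattice `T_{L^km}` (`2 ≤ L`, `2 ≤ m_i`, `k = n+1`), for every unitary background `U` with values in an averaging-closed class `S` obeying (52)
`pdev Ũ < α₀L^{−2k}` with `C₀α₀ ≤ ⅓`, `2α₀ ≤ c₂′`, `M_φM_φ′α₀ ≤ A₁`, and every `λ` with `Q′_k(U)λ = 0`:
`‖λ‖² ≤ CP·(ηL^k)²·‖D^η_Uλ‖²` — [Balaban1985BackgroundPropagators] Thm 3.11's site clause (✓`exists_site_strong_coercive_tower_of_small_plaquettes`, `a′ := 1`)
with the penalty switched off on the kernel (✓`laplacePrimeAk_apply_of_ker` via ✓`re_inner_laplacePrimeAk`).  `CP = γ⁻¹`.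
[cite: Balaban1985BackgroundPropagators, (3.24) p.394, p.395, (3.35) p.396, Thm 3.11 p.416; Balaban1985Averaging, (52) p.26; Balaban1983RegularityDecay, (2.27) p.580] -/
theorem exists_normSq_le_of_ker_QprimeTowerW :
    ∃ A₁ CP : ℝ, 0 < A₁ ∧ 0 < CP ∧
      ∀ (L : ℕ) [NeZero L], 2 ≤ L → ∀ (S : Subgroup 𝔸ˣ), AvgClosed d L S →
      ∀ (n : ℕ) (m : Fin d → ℕ) [∀ i, NeZero (m i)], (∀ i, 2 ≤ m i) →
      ∀ (U : Bond d (towerP L m (n + 1)) → 𝔸ˣ), (∀ b, U b ∈ S) → (∀ b, star (U b : 𝔸) = (((U b)⁻¹ : 𝔸ˣ) : 𝔸)) →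
      ∀ (α₀ : ℝ), 0 < α₀ → C0 d * α₀ ≤ 1 / 3 → 2 * α₀ ≤ c2' d L →
        pdev (perCfg (towerP L m (n + 1)) U) < α₀ * (((L : ℝ) ^ (n + 1))⁻¹) ^ 2 → Mφ * Mφ' * α₀ ≤ A₁ →
      ∀ (η : ℝ), 0 < η * (L : ℝ) ^ (n + 1) →
      ∀ (c₀ : ℝ) [Fact (0 < c₀)] (lam : SiteL2K ℂ d (towerP L m (n + 1)) c₀ W), QprimeTowerW L m n φ U lam = 0 →
        ‖lam‖ ^ 2 ≤ CP * (η * (L : ℝ) ^ (n + 1)) ^ 2 * ‖covDerivL2K ℂ c₀ ((η : ℂ))⁻¹ (adTransportW φ U) lam‖ ^ 2 := by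
  obtain ⟨A₁, γ, hA₁, hγ, hmain⟩ :=
    exists_site_strong_coercive_tower_of_small_plaquettes (d := d) φ τ hMφ hMφ' hφ hφ' hτφ htr (a' := 1) one_pos
  refine ⟨A₁, γ⁻¹, hA₁, inv_pos.mpr hγ, ?_⟩
  intro L _ hL S hS n m _ hm U hU hUstar α₀ hα hα3 hα2 h52 hA η hηN c₀ _ lam hlam
  -- the coarse weight of the penalty along `c₁(ηN)² = c₀N^d` (immaterial on the kernel)
  have hN : (0 : ℝ) < (L : ℝ) ^ (n + 1) := by positivity
  have hc₀ : 0 < c₀ := Fact.out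
  have hηN2 : 0 < (η * (L : ℝ) ^ (n + 1)) ^ 2 := by positivity
  obtain ⟨c₁, hc₁⟩ : ∃ c₁ : ℝ, c₁ = c₀ * ((L : ℝ) ^ (n + 1)) ^ d / (η * (L : ℝ) ^ (n + 1)) ^ 2 := ⟨_, rfl⟩
  have hc₁pos : 0 < c₁ := by rw [hc₁]; positivity
  haveI : Fact (0 < c₁) := ⟨hc₁pos⟩
  have hs : c₁ * (η * (L : ℝ) ^ (n + 1)) ^ 2 = c₀ * ((L : ℝ) ^ (n + 1)) ^ d := by
    rw [hc₁, div_mul_cancel₀ _ hηN2.ne']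
  have h := hmain L hL S hS n m hm U hU hUstar α₀ hα hα3 hα2 h52 hA η hηN c₀ c₁ hs lam
  -- on the kernel the form is `‖D_Uλ‖²`
  have hRS := hRS_of_unitary φ τ hτφ htr U hUstar
  have hform : RCLike.re ⟪lam, laplacePrimeAk L m n φ η U 1 (c₁ := c₁) lam⟫_ℂ = ‖covDerivL2K ℂ c₀ ((η : ℂ))⁻¹ (adTransportW φ U) lam‖ ^ 2 := by
    rw [re_inner_laplacePrimeAk L m n φ η U 1 hRS lam, LinearMap.comp_apply, hlam, map_zero, norm_zero]
    ring
  rw [hform] at h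
  obtain ⟨D, hD⟩ : ∃ D : ℝ, D = ‖covDerivL2K ℂ c₀ ((η : ℂ))⁻¹ (adTransportW φ U) lam‖ ^ 2 := ⟨_, rfl⟩
  rw [← hD] at h ⊢
  obtain ⟨M, hM⟩ : ∃ M : ℝ, M = ((η * (L : ℝ) ^ (n + 1))⁻¹) ^ 2 * ‖lam‖ ^ 2 := ⟨_, rfl⟩
  rw [← hM] at h
  have hD0 : 0 ≤ D := by rw [hD]; positivity
  have hM0 : 0 ≤ M := by rw [hM]; positivity
  -- `γ(D + M) ≤ D` ⇒ `γM ≤ D` ⇒ `M ≤ γ⁻¹D`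
  have h2 : γ * M ≤ D := by nlinarith [mul_nonneg hγ.le hD0]
  have h1 : M ≤ γ⁻¹ * D := by
    rw [inv_mul_eq_div, le_div_iff₀ hγ, mul_comm]; exact h2
  have h3 : ‖lam‖ ^ 2 = (η * (L : ℝ) ^ (n + 1)) ^ 2 * M := by
    rw [hM, ← mul_assoc, ← mul_pow, mul_inv_cancel₀ hηN.ne', one_pow, one_mul]
  rw [h3]
  calc (η * (L : ℝ) ^ (n + 1)) ^ 2 * M ≤ (η * (L : ℝ) ^ (n + 1)) ^ 2 * (γ⁻¹ * D) := mul_le_mul_of_nonneg_left h1 hηN2.le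
    _ = γ⁻¹ * (η * (L : ℝ) ^ (n + 1)) ^ 2 * D := by ring

end Poincare

end Summit.QuantumFields.YangMills.Theorems.Prop7KerQprimePoincareNE9

end
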